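import Summits.CriticalPhenomena.CardyFormulaZ2.Theorems.CardyFlipRussoVoronoiHubFromSmirnovOneArmEvents
import Summits.CriticalPhenomena.CardyFormulaZ2.Theorems.CardyFlipRussoVoronoiHubFromSmirnovGraphLaw
import Summits.CriticalPhenomena.CardyFormulaZ2.Theorems.CardyFlipRussoVoronoiHubFromSmirnovGraphRestrict
import Summits.CriticalPhenomena.CardyFormulaZ2.Theorems.CardyFlipRussoVoronoiHubFromSmirnovAttachmentImage
import Summits.CriticalPhenomena.CardyFormulaZ2.Theorems.CardyFlipRussoVoronoiHubFromSmirnovUnivalentInverse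
import Summits.CriticalPhenomena.CardyFormulaZ2.Theorems.CardyFlipRussoVoronoiHubFromSmirnovNoVoid
import Summits.CriticalPhenomena.CardyFormulaZ2.Theorems.CardyFlipRussoVoronoiHubFromSmirnovCrossLeGraph

/-!
# Brick L1 `stub_graphTransport_of_unitW` of the one-arm route of line
# `moebius-exact-delaunay-dilation-ward` (crux `VoronoiHubFromSmirnov`, stmt-CriticalPhenomena-6433)

**The image-side core `Sig.unitW` implies S3b-i `Sig.stub_graphTransport`.**  `Sig.unitW`
(OneArmEvents module) compares, for the HOMOGENEOUS two-colour law read on a window `V'/δ`, the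
Euclidean graph crossing event with the one pulled back by a univalent `g`;
`Sig.stub_graphTransport` (GraphDefs module) compares, for the INHOMOGENEOUS nuclei of profile
`ρ = ‖h′‖²` on `V`, the Euclidean graph crossing event with the one pulled back by `h`.  Transport
`b ↦ h(δ b)/δ` of the nuclei of `V/δ` turns the second comparison into the first one for the image
rectangle `h • R`, the inverse `g = h⁻¹` on `h(U)` (landed `univalent_inverse`), the window
`V' = h(V)` and the image families `h '' K δ`, `h '' Aᵢ δ` (landed `stub_attachmentImage`):
* (a) `P_ρ(hGraphCross K A₀ A₂ h V δ) = P₁{c|_{h(V)/δ} ∈ graphCross (h K) (h A₀) (h A₂) δ}` is the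
  landed law identity `stub_graphLaw`;
* (b) `P_ρ{c|_{V/δ} ∈ graphCross K A₀ A₂ δ} = P₁(hGraphCross (h K) (h A₀) (h A₂) g (h V) δ)`
  (`gt_window_law`): transport by `h` then by `g` is restriction to the window
  (`gt_imageRestrict_comp`), so the windowed domain event is the preimage of the image event pulled
  back by `g` (`hGraphCross_eq_preimage` for `g`); the law is pushed by `map_transport_poissonLaw`
  (Kingman mapping + restriction, Rényi uniqueness; landed S3a);
* (c) `P_ρ(graphCross K A₀ A₂ δ) − P_ρ{c|_{V/δ} ∈ graphCross K A₀ A₂ δ} → 0` (`gt_window_tendsto`):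
  off a black no-void event of radius `C√|log δ|` over a compact collar of `closure Ω` (landed
  `poisson_noVoid_tendsto`) the two events coincide (`gr_restrict_mem_graphCross_iff`).
Attachment sets are first cut down to the carrier (`graphCross` only reads `Aᵢ ∩ K`), and `h` is
replaced by its measurable modification `U.indicator h` (as in `stub_graphLaw`).

References: I. Benjamini, O. Schramm, Comm. Math. Phys. 197 (1998) 75–107, §3–§4;
J. F. C. Kingman, *Poisson Processes* (1993), §2.2–2.3.  No new definitions.
-/

noncomputable section

namespace Summit.CriticalPhenomena.CardyFormulaZ2.Cruxes.VoronoiHubFromSmirnov.MoebiusExactDelaunayDilationWard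

open scoped Topology ENNReal
open Filter Set MeasureTheory Metric
open Literature.Analysis.FunctionSpaces
open Literature.Probability.RandomPlanarGeometry
open Literature.Probability.LatticeModels (IsDelaunayPair)

/-! ### Elementary facts about the graph events and the admissible families -/

/-- The graph crossing event only reads the attachment sets inside the carrier `K` (every chain
nucleus is physically in `K`). [folklore] -/
theorem gt_graphCross_inter (K A₀ A₂ : Set ℂ) (δ : ℝ) :
    graphCross K A₀ A₂ δ = graphCross K (A₀ ∩ K) (A₂ ∩ K) δ := by
  ext c
  constructor <;> rintro ⟨N, p, h1, h2, h3, h4, h5⟩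
  exacts [⟨N, p, h1, h2, ⟨h3, h2 _⟩, ⟨h4, h2 _⟩, h5⟩, ⟨N, p, h1, h2, h3.1, h4.1, h5⟩]

/-- The pulled-back graph crossing event only reads the attachment sets inside the carrier `K`.
[folklore] -/
theorem gt_hGraphCross_inter (K A₀ A₂ : Set ℂ) (g : ℂ → ℂ) (V : Set ℂ) (δ : ℝ) :
    hGraphCross K A₀ A₂ g V δ = hGraphCross K (A₀ ∩ K) (A₂ ∩ K) g V δ := by
  ext c
  constructor <;> rintro ⟨N, p, h1, h2, h3, h4, h5⟩
  exacts [⟨N, p, h1, h2, ⟨h3, h2 _⟩, ⟨h4, h2 _⟩, h5⟩, ⟨N, p, h1, h2, h3.1, h4.1, h5⟩]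

/-- Cutting an admissible attachment family down to an admissible carrier family keeps it
admissible (the carrier family contains a `√δ`-collar of `closure Ω ⊇ R.arc i`). [folklore] -/
theorem gt_isAttachment_inter {R : ConformalRectangle} {i : Fin 4} {A K : ℝ → Set ℂ}
    (hA : IsAttachment R i A) (hK : IsDomainFamily R K) :
    IsAttachment R i fun δ => A δ ∩ K δ := by
  obtain ⟨a, b, ha, hab, hAev⟩ := hA
  obtain ⟨a', b', ha', -, hKev⟩ := hK
  have harc : R.arc i ⊆ closure R.carrier :=
    (R.arc_subset_frontier i).trans frontier_subset_closure
  refine ⟨min a a', b, lt_min ha ha', (min_le_left _ _).trans hab, ?_⟩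
  filter_upwards [hAev, hKev] with δ hAδ hKδ
  refine ⟨hAδ.1.inter hKδ.1, fun x hx => ⟨hAδ.2.1 ?_, hKδ.2.1 ?_⟩,
    inter_subset_left.trans hAδ.2.2⟩
  · exact thickening_mono (mul_le_mul_of_nonneg_right (min_le_left _ _) (Real.sqrt_nonneg _)) _ hx
  · exact thickening_subset_of_subset _ harc
      (thickening_mono (mul_le_mul_of_nonneg_right (min_le_right _ _) (Real.sqrt_nonneg _)) _ hx)

/-- Admissible carrier families are eventually measurable and inside any fixed neighbourhood
`thickening r (closure Ω)`, `r > 0`. [folklore] -/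
theorem gt_eventually_domainFamily {R : ConformalRectangle} {K : ℝ → Set ℂ}
    (hK : IsDomainFamily R K) {r : ℝ} (hr : 0 < r) :
    ∀ᶠ δ : ℝ in 𝓝[>] 0, MeasurableSet (K δ) ∧ K δ ⊆ thickening r (closure R.carrier) := by
  obtain ⟨a, b, -, -, hKev⟩ := hK
  filter_upwards [hKev, ai_eventually_mul_sqrt_lt b hr] with δ hKδ hb
  exact ⟨hKδ.1, hKδ.2.2.trans (thickening_mono hb.le _)⟩

/-! ### The pulled-back event only reads the window; transport there and back -/

/-- The pulled-back graph event only reads the nuclei of the window `V/δ` (when `K ⊆ V`).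
[folklore] -/
theorem gt_restrict_mem_hGraphCross_iff {K A₀ A₂ V : Set ℂ} (g : ℂ → ℂ) (δ : ℝ) (hKV : K ⊆ V)
    (c : PointConfig ℂ × PointConfig ℂ) :
    (PointConfig.restrict {b : ℂ | (δ : ℂ) * b ∈ V} c.1,
        PointConfig.restrict {b : ℂ | (δ : ℂ) * b ∈ V} c.2) ∈ hGraphCross K A₀ A₂ g V δ ↔
      c ∈ hGraphCross K A₀ A₂ g V δ := by
  have hts : ∀ d : PointConfig ℂ,
      transportSet g V δ (PointConfig.restrict {b : ℂ | (δ : ℂ) * b ∈ V} d) =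
        transportSet g V δ d := by
    intro d
    unfold transportSet
    rw [PointConfig.coe_eq_carrier, PointConfig.coe_eq_carrier, PointConfig.carrier_restrict,
      inter_assoc, inter_self]
  simp only [hGraphCross, mem_setOf_eq, hts]
  constructor <;> rintro ⟨N, p, h1, h2, h3, h4, h5⟩
  · exact ⟨N, p, fun i => (gr_mem_restrict_iff.1 (h1 i)).1, h2, h3, h4, h5⟩
  · exact ⟨N, p, fun i => gr_mem_restrict_iff.2 ⟨h1 i, hKV (h2 i)⟩, h2, h3, h4, h5⟩

/-- **There and back.** Transporting the nuclei of the window `V/δ` by `h` and then the nuclei of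
the image window `h(V)/δ` by a left inverse `g` of `h` on `U ⊇ V` is restriction to `V/δ`.
[folklore] -/
theorem gt_imageRestrict_comp {h g : ℂ → ℂ} {U V : Set ℂ} {δ : ℝ} (hδ : 0 < δ) (hVU : V ⊆ U)
    (hgh : LeftInvOn g h U) (hVb : Bornology.IsBounded V)
    (hV'b : Bornology.IsBounded (h '' V)) (d : PointConfig ℂ) :
    PointConfig.imageRestrict (transportMap g δ) {b : ℂ | (δ : ℂ) * b ∈ h '' V}
        (PointConfig.imageRestrict (transportMap h δ) {b : ℂ | (δ : ℂ) * b ∈ V} d) =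
      PointConfig.restrict {b : ℂ | (δ : ℂ) * b ∈ V} d := by
  have hδ' : (δ : ℂ) ≠ 0 := Complex.ofReal_ne_zero.2 hδ.ne'
  obtain ⟨Kc, hKc, hWK⟩ := exists_isCompact_window hVb hδ
  obtain ⟨Kc', hKc', hWK'⟩ := exists_isCompact_window hV'b hδ
  have hinv : ∀ b ∈ (d : Set ℂ) ∩ {b : ℂ | (δ : ℂ) * b ∈ V},
      transportMap g δ (transportMap h δ b) = b := by
    intro b hb
    simp only [transportMap]
    rw [mul_div_cancel₀ _ hδ', hgh (hVU hb.2), mul_div_cancel_left₀ _ hδ']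
  have hsub : transportMap h δ '' ((d : Set ℂ) ∩ {b : ℂ | (δ : ℂ) * b ∈ V}) ⊆
      {b : ℂ | (δ : ℂ) * b ∈ h '' V} := by
    rw [← transportMap_image_window hδ.ne']
    exact image_mono inter_subset_right
  apply SetLike.coe_injective
  rw [PointConfig.coe_imageRestrict hKc' hWK', PointConfig.coe_imageRestrict hKc hWK,
    inter_eq_left.2 hsub, image_image, PointConfig.coe_eq_carrier (PointConfig.restrict _ d),
    PointConfig.carrier_restrict, ← PointConfig.coe_eq_carrier]
  ext x
  constructor
  · rintro ⟨b, hb, rfl⟩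
    show transportMap g δ (transportMap h δ b) ∈ _
    rw [hinv b hb]
    exact hb
  · exact fun hx => ⟨x, hx, hinv x hx⟩

/-! ### (b) Exact identity: the windowed domain event is the image event pulled back by `g` -/

/-- **(b) The windowed Euclidean graph event of the inhomogeneous nuclei has the probability of
the image graph event pulled back by the inverse map** (law: `map_transport_poissonLaw`, landed S3a;
event: transport by `h`, then by `g`, is restriction to the window).  Here `h`, `g` are measurable,
`g ∘ h = id` on `U ⊇ closure V`, `ρ = ‖h′‖²` on `V`, `A₀, A₂ ⊆ K ⊆ V` measurable, `δ > 0`.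
[folklore] -/
theorem gt_window_law {h g : ℂ → ℂ} {U V : Set ℂ} (hd : DifferentiableOn ℂ h U) (hi : InjOn h U)
    (hh : Measurable h) (hg : Measurable g) (hgh : LeftInvOn g h U) (hV : IsOpen V)
    (hVb : Bornology.IsBounded V) (hVU : closure V ⊆ U) {ρ : ℂ → ℝ} (hρ : AdmissibleDensity ρ)
    (hρV : ∀ z ∈ V, ρ z = ‖deriv h z‖ ^ 2) {K A₀ A₂ : Set ℂ} {δ : ℝ} (hδ : 0 < δ)
    (hKm : MeasurableSet K) (hA₀m : MeasurableSet A₀) (hA₂m : MeasurableSet A₂) (hKV : K ⊆ V)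
    (hA₀ : A₀ ⊆ K) (hA₂ : A₂ ⊆ K) :
    (lawBW (intensity ρ 1 δ)).real
        {c | (PointConfig.restrict {b : ℂ | (δ : ℂ) * b ∈ V} c.1,
          PointConfig.restrict {b : ℂ | (δ : ℂ) * b ∈ V} c.2) ∈ graphCross K A₀ A₂ δ} =
      (lawBW (volume : Measure ℂ)).real
        (hGraphCross (h '' K) (h '' A₀) (h '' A₂) g (h '' V) δ) := by
  have hVU' : V ⊆ U := subset_closure.trans hVU
  have hcont : ContinuousOn h (closure V) := hd.continuousOn.mono hVU
  have hopen : IsOpen (h '' V) := isOpen_image_of_injOn_closure hV hcont (hi.mono hVU)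
  have hV'b : Bornology.IsBounded (h '' V) :=
    (hVb.isCompact_closure.image_of_continuousOn hcont).isBounded.subset (image_mono subset_closure)
  have hginj : InjOn g (h '' U) := LeftInvOn.injOn hgh.rightInvOn_image
  obtain ⟨Kc, hKc, hWK⟩ := exists_isCompact_window hVb hδ
  obtain ⟨Kc', hKc', hWK'⟩ := exists_isCompact_window hV'b hδ
  set T : PointConfig ℂ → PointConfig ℂ :=
    PointConfig.imageRestrict (transportMap h δ) {b | (δ : ℂ) * b ∈ V} with hT
  set Rs : PointConfig ℂ → PointConfig ℂ := PointConfig.restrict {b : ℂ | (δ : ℂ) * b ∈ h '' V}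
  set Tg : PointConfig ℂ → PointConfig ℂ :=
    PointConfig.imageRestrict (transportMap g δ) {b | (δ : ℂ) * b ∈ h '' V} with hTg
  set H : Set (PointConfig ℂ × PointConfig ℂ) :=
    hGraphCross (h '' K) (h '' A₀) (h '' A₂) g (h '' V) δ
  have hTm : Measurable T := PointConfig.measurable_imageRestrict hKc hWK
    (isOpen_window hV δ).measurableSet (measurable_transportMap hh δ)
    (injOn_transportMap (hi.mono hVU') hδ.ne')
  have hRsm : Measurable Rs := PointConfig.measurable_restrict (isOpen_window hopen δ).measurableSet
  have hTgm : Measurable Tg := PointConfig.measurable_imageRestrict hKc' hWK'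
    (isOpen_window hopen δ).measurableSet (measurable_transportMap hg δ)
    (injOn_transportMap (hginj.mono (image_mono hVU')) hδ.ne')
  have hlaw : (poissonLaw (intensity ρ 1 δ)).map T = (poissonLaw volume).map Rs :=
    map_transport_poissonLaw hd hi hh hV hVb hVU hρ hρV hδ
  have hG : MeasurableSet (graphCross K A₀ A₂ δ) :=
    measurableSet_graphCross _ _ _ δ hKm hA₀m hA₂m hδ
  -- the image event pulled back by `g` is the `Tg`-preimage of the domain event
  have hH : H = (fun c : PointConfig ℂ × PointConfig ℂ => (Tg c.1, Tg c.2)) ⁻¹'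
      graphCross K A₀ A₂ δ := by
    have e := hGraphCross_eq_preimage (h := g) (U := h '' U) (V := h '' V) (K := h '' K)
      (A₀ := h '' A₀) (A₂ := h '' A₂) hginj (image_mono hVU') (image_mono hKV) (image_mono hA₀)
      (image_mono hA₂) hδ hKc' hWK'
    rwa [hgh.image_image' (hKV.trans hVU'), hgh.image_image' ((hA₀.trans hKV).trans hVU'),
      hgh.image_image' ((hA₂.trans hKV).trans hVU')] at e
  have hHm : MeasurableSet H := hH ▸ (hTgm.prodMap hTgm) hG
  -- the windowed domain event is the `T`-preimage of the image event
  have hGw : {c : PointConfig ℂ × PointConfig ℂ |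
      (PointConfig.restrict {b : ℂ | (δ : ℂ) * b ∈ V} c.1,
        PointConfig.restrict {b : ℂ | (δ : ℂ) * b ∈ V} c.2) ∈ graphCross K A₀ A₂ δ} =
      Prod.map T T ⁻¹' H := by
    rw [hH]
    ext c
    simp only [mem_preimage, mem_setOf_eq, Prod.map_fst, Prod.map_snd, hT, hTg]
    rw [gt_imageRestrict_comp hδ hVU' hgh hVb hV'b, gt_imageRestrict_comp hδ hVU' hgh hVb hV'b]
  -- push the two-colour law
  have hprod : (lawBW (intensity ρ 1 δ)).map (Prod.map T T) =
      (lawBW (volume : Measure ℂ)).map (Prod.map Rs Rs) := by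
    haveI := isProbabilityMeasure_poissonLaw_intensity ρ hρ.continuous 1 δ
    haveI := isPoissonPointProcess_poissonLaw_volume.isProbabilityMeasure
    unfold lawBW
    rw [← Measure.map_prod_map _ _ hTm hTm, ← Measure.map_prod_map _ _ hRsm hRsm, hlaw]
  rw [hGw, measureReal_def, measureReal_def, ← Measure.map_apply (hTm.prodMap hTm) hHm, hprod,
    Measure.map_apply (hRsm.prodMap hRsm) hHm]
  congr 2
  ext c
  exact gt_restrict_mem_hGraphCross_iff g δ (image_mono hKV) c

/-! ### (c) Locality: the windowed and the full domain events agree off a no-void event -/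

/-- **(c) at a fixed mesh.**  If `K ⊆ K' ⊆ V`, the open `2t`-balls (configuration coordinates)
around the nuclei over `K'` are physically in `V` and the closed `t`-balls physically in `Kc`, then
the probabilities of the Euclidean graph event and of its windowed version (nuclei of `V/δ` only)
differ by at most the probability of a black void of radius `t` over `Kc`. [folklore] -/
theorem gt_abs_sub_window_le {ρ : ℂ → ℝ} (hρ : AdmissibleDensity ρ) {K K' V Kc A₀ A₂ : Set ℂ}
    {δ t : ℝ} (hδ : 0 < δ) (ht : 0 ≤ t) (hKK' : K ⊆ K') (hK'V : K' ⊆ V)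
    (h2s : ∀ p w : ℂ, (δ : ℂ) * p ∈ K' → dist w p < 2 * t → (δ : ℂ) * w ∈ V)
    (hKc : ∀ p y : ℂ, (δ : ℂ) * p ∈ K' → dist y p ≤ t → (δ : ℂ) * y ∈ Kc) :
    |(lawBW (intensity ρ 1 δ)).real (graphCross K A₀ A₂ δ) -
        (lawBW (intensity ρ 1 δ)).real
          {c | (PointConfig.restrict {b : ℂ | (δ : ℂ) * b ∈ V} c.1,
            PointConfig.restrict {b : ℂ | (δ : ℂ) * b ∈ V} c.2) ∈ graphCross K A₀ A₂ δ}| ≤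
      (poissonLaw (intensity ρ 1 δ)).real
        {c | ∃ z ∈ Kc, ∀ q ∈ c, t ≤ dist q (z / (δ : ℂ))} := by
  haveI := isProbabilityMeasure_lawBW_intensity ρ hρ.continuous 1 δ
  haveI := isProbabilityMeasure_poissonLaw_intensity ρ hρ.continuous 1 δ
  have hδ' : (δ : ℂ) ≠ 0 := Complex.ofReal_ne_zero.2 hδ.ne'
  set E : Set (PointConfig ℂ) := {c | ∃ z ∈ Kc, ∀ q ∈ c, t ≤ dist q (z / (δ : ℂ))} with hE
  have hgood : ∀ c : PointConfig ℂ × PointConfig ℂ,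
      c ∉ {c : PointConfig ℂ × PointConfig ℂ | c.1 ∈ E} →
      (c ∈ graphCross K A₀ A₂ δ ↔ c ∈ {c : PointConfig ℂ × PointConfig ℂ |
        (PointConfig.restrict {b : ℂ | (δ : ℂ) * b ∈ V} c.1,
          PointConfig.restrict {b : ℂ | (δ : ℂ) * b ∈ V} c.2) ∈ graphCross K A₀ A₂ δ}) := by
    intro c hc
    simp only [mem_setOf_eq, hE] at hc
    push Not at hc
    refine (gr_restrict_mem_graphCross_iff ht hKK' hK'V h2s c fun p y hp hy => ?_).symm
    obtain ⟨q, hq, hqy⟩ := hc ((δ : ℂ) * y) (hKc p y hp hy)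
    refine ⟨q, hq, ?_⟩
    rwa [mul_div_cancel_left₀ _ hδ'] at hqy
  exact (abs_measureReal_sub_le_of_iff _ _ _ _ hgood).trans (cle_lawBW_real_fst_le _ E)

/-- **Locality of the inhomogeneous graph event** (no giant cells, `poisson_noVoid_tendsto`):
reading the Euclidean graph crossing event of an admissible carrier family on the nuclei of the
window `V/δ` only (`V` open, `closure Ω ⊆ V`) changes its probability by `o(1)` as `δ → 0⁺`.
[folklore] -/
theorem gt_window_tendsto {R : ConformalRectangle} {V : Set ℂ} (hV : IsOpen V)
    (hΩV : closure R.carrier ⊆ V) {ρ : ℂ → ℝ} (hρ : AdmissibleDensity ρ) {K : ℝ → Set ℂ}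
    (hK : IsDomainFamily R K) (A₀ A₂ : ℝ → Set ℂ) :
    Tendsto (fun δ : ℝ => (lawBW (intensity ρ 1 δ)).real (graphCross (K δ) (A₀ δ) (A₂ δ) δ) -
      (lawBW (intensity ρ 1 δ)).real
        {c | (PointConfig.restrict {b : ℂ | (δ : ℂ) * b ∈ V} c.1,
          PointConfig.restrict {b : ℂ | (δ : ℂ) * b ∈ V} c.2) ∈
            graphCross (K δ) (A₀ δ) (A₂ δ) δ}) (𝓝[>] 0) (𝓝 0) := by
  have hΩc : IsCompact (closure R.carrier) := R.isBounded.isCompact_closure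
  obtain ⟨d₀, hd₀, hthick⟩ := hΩc.exists_thickening_subset_open hV hΩV
  have hd3 : 0 < d₀ / 3 := by positivity
  set K' : Set ℂ := cthickening (d₀ / 3) (closure R.carrier)
  obtain ⟨C, hC, hvoid⟩ :=
    poisson_noVoid_tendsto ρ hρ (cthickening (d₀ / 3) K') hΩc.cthickening.cthickening
  have hK'V : K' ⊆ V := (cthickening_subset_thickening' hd₀ (by linarith) _).trans hthick
  have hK'V' : thickening (d₀ / 3) K' ⊆ V :=
    ((thickening_cthickening_subset (d₀ / 3) hd3.le _).trans
      (thickening_mono (by linarith) _)).trans hthick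
  refine squeeze_zero_norm' ?_ hvoid
  filter_upwards [gt_eventually_domainFamily hK hd3, cle_eventually_scale hC one_pos,
    ai_eventually_mul_sqrt_lt 1 (by positivity : (0:ℝ) < d₀ / 6), self_mem_nhdsWithin]
    with δ hKδ hsc h6 hδ0
  have hδ : (0:ℝ) < δ := hδ0
  rw [Real.norm_eq_abs]
  have hδt : δ * (C * Real.sqrt |Real.log δ|) < d₀ / 6 :=
    calc δ * (C * Real.sqrt |Real.log δ|) = C * Real.sqrt |Real.log δ| * δ := by ring
      _ ≤ 1 * Real.sqrt δ := hsc.1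
      _ < d₀ / 6 := h6
  have hdist : ∀ p w : ℂ, dist ((δ : ℂ) * w) ((δ : ℂ) * p) = δ * dist w p := fun p w => by
    rw [dist_eq_norm, dist_eq_norm, ← mul_sub, norm_mul, Complex.norm_of_nonneg hδ.le]
  refine gt_abs_sub_window_le hρ hδ (by positivity)
    (hKδ.2.trans (thickening_subset_cthickening _ _)) hK'V
    (fun p w hp hw => hK'V' (mem_thickening_iff.2 ⟨_, hp, ?_⟩)) fun p y hp hy =>
    mem_cthickening_of_dist_le _ _ _ _ hp ?_
  · rw [hdist]
    calc δ * dist w p < δ * (2 * (C * Real.sqrt |Real.log δ|)) := mul_lt_mul_of_pos_left hw hδ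
      _ ≤ d₀ / 3 := by linarith
  · rw [hdist]
    calc δ * dist y p ≤ δ * (C * Real.sqrt |Real.log δ|) := mul_le_mul_of_nonneg_left hy hδ.le
      _ ≤ d₀ / 3 := by linarith

/-! ### Assembly -/

/-- **L1 for measurable `h` and attachment sets inside the carrier**: `Sig.unitW` for `h • R`,
`g = h⁻¹` on `h(U)`, `h(V)` and the image families, through (a), (b), (c). [folklore] -/
theorem gt_core (hW : Sig.unitW) {R : ConformalRectangle} {h : ℂ → ℂ} {U : Set ℂ} (hU : IsOpen U)
    (hRU : closure R.carrier ⊆ U) (hd : DifferentiableOn ℂ h U) (hi : InjOn h U)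
    (hh : Measurable h) {V : Set ℂ} (hV : IsOpen V) (hVb : Bornology.IsBounded V)
    (hΩV : closure R.carrier ⊆ V) (hVU : closure V ⊆ U) {ρ : ℂ → ℝ} (hρ : AdmissibleDensity ρ)
    (hρV : ∀ z ∈ V, ρ z = ‖deriv h z‖ ^ 2) {K A₀ A₂ : ℝ → Set ℂ} (hK : IsDomainFamily R K)
    (hA₀ : IsAttachment R 0 A₀) (hA₂ : IsAttachment R 2 A₂) (hA₀K : ∀ δ, A₀ δ ⊆ K δ)
    (hA₂K : ∀ δ, A₂ δ ⊆ K δ) :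
    Tendsto (fun δ => (lawBW (intensity ρ 1 δ)).real (graphCross (K δ) (A₀ δ) (A₂ δ) δ)
      - (lawBW (intensity ρ 1 δ)).real (hGraphCross (K δ) (A₀ δ) (A₂ δ) h V δ))
      (𝓝[>] 0) (𝓝 0) := by
  -- the inverse map and the image data
  obtain ⟨hU'o, hgd, hgi, hgh, -, -⟩ := univalent_inverse h U hU hd hi
  set g : ℂ → ℂ := Function.invFunOn h U
  have hVU' : V ⊆ U := subset_closure.trans hVU
  have hcont : ContinuousOn h (closure V) := hd.continuousOn.mono hVU
  have hV'o : IsOpen (h '' V) := isOpen_image_of_injOn_closure hV hcont (hi.mono hVU)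
  have hV'b : Bornology.IsBounded (h '' V) :=
    (hVb.isCompact_closure.image_of_continuousOn hcont).isBounded.subset (image_mono subset_closure)
  have hclV' : closure (h '' V) ⊆ h '' U := by
    rw [closure_image_of_isBounded hVb hcont]
    exact image_mono hVU
  set R' : ConformalRectangle := R.imageUnivalent h (hd.mono hRU) (hi.mono hRU)
  have hR'cl : closure R'.carrier = h '' closure R.carrier :=
    MarkedDomain.closure_carrier_imageUnivalent R h _ _
  obtain ⟨hatt, hdom⟩ := stub_attachmentImage R h U hU hRU hd hi
  -- the image-side core
  have hWlim : Tendsto (fun δ : ℝ => (lawBW (volume : Measure ℂ)).real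
      {c | (PointConfig.restrict {b : ℂ | (δ : ℂ) * b ∈ h '' V} c.1,
        PointConfig.restrict {b : ℂ | (δ : ℂ) * b ∈ h '' V} c.2) ∈
          graphCross (h '' K δ) (h '' A₀ δ) (h '' A₂ δ) δ}
      - (lawBW (volume : Measure ℂ)).real
          (hGraphCross (h '' K δ) (h '' A₀ δ) (h '' A₂ δ) g (h '' V) δ)) (𝓝[>] 0) (𝓝 0) :=
    hW R' g (h '' U) hU'o (hR'cl ▸ image_mono hRU) hgd hgi (h '' V) hV'o hV'b
      (hR'cl ▸ image_mono hΩV) hclV' _ _ _ (hdom K hK) (hatt 0 A₀ hA₀) (hatt 2 A₂ hA₂)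
  -- a measurable modification of `g` off `h '' U`
  set g' : ℂ → ℂ := (h '' U).indicator g
  have hg'm : Measurable g' := measurable_indicator_of_continuousOn hU'o hgd.continuousOn
  have heqg : EqOn g g' (h '' U) := fun x hx => (Set.indicator_of_mem hx g).symm
  have hg'h : LeftInvOn g' h U := fun z hz => by
    rw [← heqg ⟨z, hz, rfl⟩]
    exact hgh z hz
  -- combine (c) with `Sig.unitW` through the exact identities (a), (b), eventually
  obtain ⟨d₀, hd₀, hthick⟩ := R.isBounded.isCompact_closure.exists_thickening_subset_open hV hΩV
  obtain ⟨_, _, -, -, hA₀ev⟩ := hA₀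
  obtain ⟨_, _, -, -, hA₂ev⟩ := hA₂
  have hlim := (gt_window_tendsto hV hΩV hρ hK A₀ A₂).sub hWlim
  rw [sub_zero] at hlim
  refine hlim.congr' ?_
  filter_upwards [gt_eventually_domainFamily hK hd₀, hA₀ev, hA₂ev, self_mem_nhdsWithin]
    with δ hKδ hA₀δ hA₂δ hδ0
  have hδ : (0:ℝ) < δ := hδ0
  have hKV : K δ ⊆ V := hKδ.2.trans hthick
  rw [gt_window_law hd hi hh hg'm hg'h hV hVb hVU hρ hρV hδ hKδ.1 hA₀δ.1 hA₂δ.1 hKV (hA₀K δ)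
      (hA₂K δ), hGraphCross_congr (heqg.symm.mono (image_mono hVU')) (image_mono hKV) δ,
    stub_graphLaw R h U hU hRU hd hi V hV hVb hΩV hVU ρ hρ hρV (K δ) (A₀ δ) (A₂ δ) δ hδ hKδ.1 hA₀δ.1
      hA₂δ.1 hKV (hA₀K δ) (hA₂K δ)]
  ring

/-- **Brick L1 of the one-arm route: the image-side core `Sig.unitW` implies S3b-i
`Sig.stub_graphTransport`.**  Transport the inhomogeneous nuclei of the window `V/δ` by
`b ↦ h(δ b)/δ`: in law they become the homogeneous nuclei of `h(V)/δ` (`map_transport_poissonLaw`);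
the graph event pulled back by `h` becomes the Euclidean graph event of the image families
(`stub_graphLaw`) and the Euclidean graph event read on the window becomes the graph event pulled
back by the inverse `g = h⁻¹` (`gt_window_law`); restricting to the window costs `o(1)` (no giant
cells, `gt_window_tendsto`); and `Sig.unitW` for the image rectangle `h • R`, the univalent inverse
`g` on `h(U)` (`univalent_inverse`) and the image families (`stub_attachmentImage`) is the
remaining difference.  Attachments are first cut down to the carrier and `h` is replaced by its
measurable modification `U.indicator h`. -/
theorem stub_graphTransport_of_unitW : Sig.unitW → Sig.stub_graphTransport := by
  intro hW R h U hU hRU hd hi V hV hVb hΩV hVU ρ hρ hρV K A₀ A₂ hK hA₀ hA₂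
  -- measurable modification of `h` off `U`
  set h' : ℂ → ℂ := U.indicator h
  have heqU : EqOn h h' U := fun x hx => (Set.indicator_of_mem hx h).symm
  have hh'm : Measurable h' := measurable_indicator_of_continuousOn hU hd.continuousOn
  have hd' : DifferentiableOn ℂ h' U := hd.congr fun x hx => (heqU hx).symm
  have hi' : InjOn h' U := hi.congr heqU
  have hVU' : V ⊆ U := subset_closure.trans hVU
  have hρV' : ∀ z ∈ V, ρ z = ‖deriv h' z‖ ^ 2 := fun z hz => by
    rw [hρV z hz]
    congr 2
    refine Filter.EventuallyEq.deriv_eq ?_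
    filter_upwards [hU.mem_nhds (hVU' hz)] with w hw
    exact heqU hw
  -- attachments cut down to the carrier
  have hcore := gt_core hW hU hRU hd' hi' hh'm hV hVb hΩV hVU hρ hρV' hK
    (gt_isAttachment_inter hA₀ hK) (gt_isAttachment_inter hA₂ hK) (fun δ => inter_subset_right)
    (fun δ => inter_subset_right)
  obtain ⟨d₀, hd₀, hthick⟩ := R.isBounded.isCompact_closure.exists_thickening_subset_open hV hΩV
  refine hcore.congr' ?_
  filter_upwards [gt_eventually_domainFamily hK hd₀] with δ hKδ
  rw [← gt_graphCross_inter, ← gt_hGraphCross_inter,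
    hGraphCross_congr (heqU.mono hVU') (hKδ.2.trans hthick) δ]

end Summit.CriticalPhenomena.CardyFormulaZ2.Cruxes.VoronoiHubFromSmirnov.MoebiusExactDelaunayDilationWard

end
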